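import Literature.Analysis.FluidPDE.LuoTitiPerturbationFracNSR
import Literature.Analysis.FluidPDE.LuoTitiHyperviscous
import Literature.Analysis.FluidPDE.LuoTitiEstimates
import Literature.Analysis.FluidPDE.JetF1Estimate
import HarnessLib

/-!
# Luo–Titi's perturbation step at fixed parameters: the three size bounds
  (Luo–Titi 2020, §3.4–§3.5, symbolic parameters)

Analysis/FluidPDE support file (everything proved; no named facts) for the proof of the Iteration
Lemma of T. Luo and E. S. Titi, Calc. Var. PDE 59 (2020) = arXiv:1808.07595
(`Torus.LuoTiti2020_iterationLemma`). For a valid set-up `S` (jet datum + temporal cut-off,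
`LuoTitiPerturbation`) and a solution `(v, p, R = S.D.M)` of (2.1) on `ℝ × 𝕋³`, the new triple
`(v + w, newPressure, newStress)` of `LuoTitiPerturbationFracNSR` satisfies, at EVERY time,
  `‖w(t)‖_{L²} ≤ √E_p + √E_r`, `‖w(t)‖_{L¹} ≤ incL1`, `‖R_new(t)‖_{L¹} ≤ stress`,
with explicit algebraic size functions (`LuoTiti.Consts.*`) of the parameters `μ, κ, σ, μ′, p` and
of finitely many constants fixed BEFORE the parameters (amplitude bounds `A₀, A₁, A₂, H₁, H₂`,
jet bounds `B`, block bounds `K`, `C⁴` amplitude bound `Ca`, the operator constants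
`C₂, C_ℛ, C₁, C_h`, `sup‖v‖ ≤ V₀`, `sup|ψ′| ≤ Ψ₁`, `sup_t‖R(t)‖_{L¹} ≤ δ_M`): the sizes of the
tree's jet step (`JetVelocityEstimates`, `JetStressEstimates`, `JetF1Estimate`, as assembled in
`JetStepTheorem`) combined with the cut-off bookkeeping (`LuoTitiEstimates`) and the hyperviscous
term (`LuoTitiHyperviscous`). The choice of the parameters along the curve of `LuoTitiParameters`
and the verification that every size tends to zero is done separately.

## References

* T. Luo, E. S. Titi, Calc. Var. PDE 59 (2020) = arXiv:1808.07595, §3.4 (3.14)–(3.15), §3.5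
  (3.17)–(3.21). [`LuoTiti2020`]
* T. Buckmaster, V. Vicol, EMS Surv. Math. Sci. 6 (2019) = arXiv:1901.09023, §7.5–§7.7. [`BuckmasterVicol2020`]
-/

noncomputable section

open MeasureTheory Set Filter Topology Function UnitAddTorus
open scoped InnerProductSpace ContDiff ENNReal NNReal

namespace Literature.Analysis.FluidPDE

namespace LuoTiti

open Literature.Analysis.FunctionSpaces FunctionSpaces.Torus Mikado NashGeometric Jet JetStep

local notation "𝕋³" => UnitAddTorus (Fin 3)
local notation "E³" => EuclideanSpace ℝ (Fin 3)
local notation "Idx" => Index (Fin 3)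

/-! ## The constants and the size functions -/

/-- **The constants of one Luo–Titi step** (all fixed before the large parameter). [folklore] -/
structure Consts where
  /-- amplitude bounds -/
  A₀ : ℝ
  A₁ : ℝ
  A₂ : ℝ
  H₁ : ℝ
  H₂ : ℝ
  /-- jet bounds -/
  B : ℝ
  /-- `L²` Hessian constant -/
  C₂ : ℝ
  /-- `ℛ div` on `L^{p}` -/
  Cℛ : ℝ
  /-- `ℛ` on `L¹` -/
  C₁ : ℝ
  /-- hyperviscous `sup × |supp|^{1/p}` constant -/
  Ch : ℝ
  /-- block bounds (order 4) -/
  K : ℝ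
  /-- `C⁴` amplitude bound -/
  Ca : ℝ
  /-- `sup‖v‖` -/
  V₀ : ℝ
  /-- `sup|ψ′|` -/
  Ψ₁ : ℝ
  /-- `sup_t ∫‖R(t)‖` -/
  δM : ℝ
  /-- integrability exponent `p ∈ (1, 2]` -/
  pr : ℝ
  /-- hyperviscosity exponent and viscosity -/
  θ : ℝ
  ν : ℝ
  /-- unit-ball volume constant `∑_x |B_{E_x}(0,1)|` -/
  vB : ℝ

namespace Consts

variable (c : Consts) (D : Datum)

/-- `∫‖wp‖² ≤ Ep`. [folklore] -/
def Ep : ℝ := NN * (5 * (2 / radius (Fin 3) * (D.γ₀ + 3 * c.δM) + 3 * c.H₁ * (Real.sqrt 3 / D.σ)))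
/-- `∫‖wp‖ ≤ Lp`. [folklore] -/
def Lp : ℝ := NN * (3 * c.A₀ * (c.B * D.κ ^ (-(1 / 2 : ℝ)) * D.μ⁻¹))
/-- `sup‖wpc - wp‖ ≤ Sc`. [folklore] -/
def Sc : ℝ := NN * (3 * (c.B ^ 2 * (5 * c.A₀ * D.κ ^ (3 / 2 : ℝ) + 36 * c.A₁ * D.κ ^ (1 / 2 : ℝ) * (D.σ : ℝ)⁻¹)))
/-- `∫‖wpc - wp‖ ≤ Lc`. [folklore] -/
def Lc : ℝ := NN * (3 * (c.B * (5 * c.A₀ * (D.κ ^ (1 / 2 : ℝ) * D.μ ^ (-(2 : ℝ))) +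
      36 * c.A₁ * (D.κ ^ (-(1 / 2 : ℝ)) * (D.σ : ℝ)⁻¹ * D.μ ^ (-(2 : ℝ))))))
/-- `∫‖X‖² ≤ EX`. [folklore] -/
def EX : ℝ := NN * (NN * (9 * (D.mup⁻¹) ^ 2 * (c.A₀ ^ 4 * (c.B * D.κ * D.μ ^ 2))))
/-- `‖∂ᵢζ‖_{L²} ≤ Z`. [folklore] -/
def Z : ℝ := 3 * (c.C₂ * (2 * Real.sqrt (c.EX D)))
/-- `∫‖∇ζ‖² ≤ Eζ`. [folklore] -/
def Eζ : ℝ := 3 * c.Z D ^ 2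
/-- `∫‖wr‖² ≤ Er = 3(Sc Lc + EX + Eζ)`. [folklore] -/
def Er : ℝ := 3 * (c.Sc D * c.Lc D + c.EX D + c.Eζ D)
/-- `∫‖S_osc‖ ≤ LS`. [folklore] -/
def LS : ℝ := NN * (2 * (27 * c.H₁) * (3 * (c.B * (D.σ : ℝ)⁻¹)))
/-- `∫‖f₂‖ ≤ Lf₂`. [folklore] -/
def Lf₂ : ℝ := NN * ((2 * 3 + 1) * (27 * c.H₂) * (3 * (c.B * (D.σ : ℝ)⁻¹)))
/-- `∫‖f₃‖ ≤ Lf₃`. [folklore] -/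
def Lf₃ : ℝ := NN * (3 * D.mup⁻¹ * c.H₁)
/-- `∫‖ℛf₁‖ ≤ Lf₁`. [folklore] -/
def Lf₁ : ℝ := NN * (c.Cℛ * (3 * (3 * (6 * c.A₁ * D.Keta c.B c.pr + 30 * D.σ * D.mup * c.A₀ * D.KetaD c.B c.pr))))
/-- The first-derivative sup bound `S₁` of `wloc`. [folklore] -/
def S₁ : ℝ := NN * (3 * (2 ^ 4 * c.Ca * (c.K * Real.sqrt D.κ * ((D.σ : ℝ))⁻¹) * D.Lstar)) * D.Lstar +
  NN * (2 ^ 3 * (D.mup⁻¹ * (2 ^ 3 * (2 ^ 3 * c.Ca * c.Ca) * (c.K * D.κ * D.μ ^ 2))) * 3) * D.Lstar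
/-- The measure bound `vE = vB κ⁻¹ (1/(4μ))²` of the jet supports. [folklore] -/
def vE : ℝ := c.vB * (D.κ⁻¹ * (1 / 4 / D.μ) ^ 2)
/-- `∫‖ℛ(ν(-Δ)^θ wloc)‖ ≤ Hν`. [folklore] -/
def Hν : ℝ := |c.ν| * (c.Ch * (c.vE D ^ (1 / c.pr) * (c.S₁ D ^ (2 - c.θ) * (3 * (c.S₁ D * D.Lstar ^ 2)) ^ (c.θ - 1))))
/-- The `L²` increment bound. [folklore] -/
def incL2 : ℝ := Real.sqrt (c.Ep D) + Real.sqrt (c.Er D)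
/-- The `L¹` increment bound. [folklore] -/
def incL1 : ℝ := c.Lp D + c.Lc D + Real.sqrt (c.EX D) + Real.sqrt (c.Eζ D)
/-- The `L¹` stress bound. [folklore] -/
def stress : ℝ :=
  ((2 * (Real.sqrt (c.Ep D) * Real.sqrt (c.Er D)) + c.Er D) + c.LS D +
      (2 * (Real.sqrt (2 * (c.Ep D + c.Sc D * c.Lc D)) * Real.sqrt (2 * (c.EX D + c.Eζ D))) + 2 * (c.EX D + c.Eζ D))) +
    2 * c.V₀ * c.incL1 D +
    ((c.Lf₁ D + c.C₁ * (2 * (c.Lf₂ D + c.Lf₃ D))) + c.Ψ₁ * (c.C₁ * (c.Lp D + c.Lc D)) + c.Lf₁ D + 2 * c.Ψ₁ * (c.C₁ * Real.sqrt (c.EX D))) +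
    c.Hν D

end Consts

/-! ## The hypotheses of the step -/

/-- **The constants are admissible for the set-up `S` and the velocity `v`**: the packages they
bound. [folklore] -/
structure Consts.Admissible (c : Consts) (S : Setup) (v : ℝ → 𝕋³ → E³) : Prop where
  hAmp : S.D.AmpBounds c.A₀ c.A₁ c.A₂ c.H₁ c.H₂
  hB1 : 1 ≤ c.B
  hBD : ∀ x t, Jet.Bounds c.B (S.D.J x) S.D.s x t
  hC₂0 : 0 ≤ c.C₂
  hC₂ : ∀ w : 𝕋³ → ℝ, Torus.IsSmooth w → ∀ j k : Fin 3,
    eLpNorm (Torus.partialDeriv j (Torus.partialDeriv k w)) 2 volume ≤ ENNReal.ofReal c.C₂ * eLpNorm (Torus.laplacian w) 2 volume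
  hpr1 : 1 < c.pr
  hpr2 : c.pr ≤ 2
  hCℛ0 : 0 ≤ c.Cℛ
  hCℛ : ∀ A : 𝕋³ → Fin 3 → E³, Torus.IsSmooth A → eLpNorm (Torus.antidivergence (Torus.tensorDivergence A)) (ENNReal.ofReal c.pr) volume ≤
    ENNReal.ofReal c.Cℛ * ∑ m, eLpNorm (fun y => A y m) (ENNReal.ofReal c.pr) volume
  hC₁0 : 0 ≤ c.C₁
  hC₁ : ∀ g : 𝕋³ → E³, Torus.IsSmooth g → eLpNorm (Torus.antidivergence g) 1 volume ≤ ENNReal.ofReal c.C₁ * eLpNorm g 1 volume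
  hCh0 : 0 ≤ c.Ch
  hCh : ∀ u : 𝕋³ → E³, Torus.IsSmooth u → ∀ E : Set 𝕋³, MeasurableSet E →
    (∀ m, ∀ y ∉ E, Torus.partialDeriv m u y = 0) → (∀ m, ∀ y ∉ E, Torus.laplacian (Torus.partialDeriv m u) y = 0) →
    ∀ S₁ S₃ : ℝ, 0 ≤ S₁ → 0 ≤ S₃ → (∀ m y, ‖Torus.partialDeriv m u y‖ ≤ S₁) →
    (∀ m y, ‖Torus.laplacian (Torus.partialDeriv m u) y‖ ≤ S₃) →
    eLpNorm (Torus.antidivergence (Torus.fracLaplacian c.θ u)) 1 volume ≤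
      ENNReal.ofReal c.Ch * (volume E ^ (1 / (ENNReal.ofReal c.pr).toReal) * ENNReal.ofReal (S₁ ^ (2 - c.θ) * S₃ ^ (c.θ - 1)))
  hK : S.D.BlockBounds 4 c.K
  hκμ : S.D.κ ≤ S.D.μ
  ha : ∀ x, ∀ t ∈ Icc 0 S.D.T, HasDerivBounds 4 (S.D.a x t) c.Ca 1
  hV : ∀ t ∈ Icc 0 S.D.T, ∀ y, ‖v t y‖ ≤ c.V₀
  hΨ : ∀ t, |deriv S.ψ t| ≤ c.Ψ₁
  hδM : ∀ t, ∫ y, ‖S.D.M t y‖ ≤ c.δM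
  hvB : ∑ x : Idx, (volume (Metric.ball (0 : EuclideanSpace ℝ (Slot x)) 1)).toReal ≤ c.vB
  hθ1 : 1 ≤ c.θ
  hθ2 : c.θ < 2

namespace Setup

variable {S : Setup} (h : S.Valid)
include h

omit h in
/-- Off `tsupport ψ` the increment and the new stress vanish. [cite: LuoTiti2020, §3.4 (3.13)] -/
theorem w_newStress_eq_zero_of_not_mem {θ ν : ℝ} (v : ℝ → 𝕋³ → E³) {t : ℝ} (ht : t ∉ tsupport S.ψ) :
    S.w t = 0 ∧ newStress θ ν S v t = fun _ _ => 0 := by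
  obtain ⟨hw0, hwl0, -, hS0, -, hf0⟩ := eq_zero_of_not_mem (S := S) ht
  refine ⟨hw0, ?_⟩
  funext y j
  simp only [newStress, hS0, hw0, hf0, hwl0]
  rw [Torus.fracLaplacian_zero_fun]
  simp only [Pi.zero_apply, smul_zero, add_zero]
  rw [show (fun _ : 𝕋³ => (0 : E³)) = 0 from rfl, Torus.antidivergence_zero]
  simp [Torus.tensorProd]

/-- **The three size bounds of the Luo–Titi step at fixed parameters.** For a valid set-up `S`, a
solution `(v, p, R = S.D.M)` of (2.1) on `ℝ × 𝕋³` with `θ > 0`, and admissible constants `c`: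
at every time `t`,
  `‖w(t)‖_{L²} ≤ incL2`, `‖w(t)‖_{L¹} ≤ incL1`, `‖newStress(t)‖_{L¹} ≤ stress`.
[cite: LuoTiti2020, §3.4 (3.14)–(3.15), §3.5 (3.17)–(3.21)] -/
theorem step_bounds {θ ν : ℝ} {v : ℝ → 𝕋³ → E³} {P : ℝ → 𝕋³ → ℝ} (hv : Torus.IsFracNSReynoldsOn univ θ ν v P S.D.M)
    {c : Consts} (hc : c.Admissible S v) (hcθ : c.θ = θ) (hcν : c.ν = ν) :
    (∀ t, eLpNorm (S.w t) 2 volume ≤ ENNReal.ofReal (c.incL2 S.D)) ∧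
    (∀ t, ∫ y, ‖S.w t y‖ ≤ c.incL1 S.D) ∧
    (∀ t, ∫ y, ‖newStress θ ν S v t y‖ ≤ c.stress S.D) := by
  have hD := h.hD
  obtain ⟨hμ0, hκ0, hσ0, hmup, hμ1, hκ1, hσ1⟩ := Datum.pos hD
  have hθ0 : 0 < θ := by have := hc.hθ1; rw [hcθ] at this; linarith
  have hAmp := hc.hAmp
  have hA0 := hAmp.hA₀; have hA1 := hAmp.hA₁; have hH1 := hAmp.hH₁; have hH2 := hAmp.hH₂
  have hB1 := hc.hB1
  have hB0 : 0 ≤ c.B := zero_le_one.trans hB1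
  have hBD := hc.hBD
  have hr := radius_pos Datum.hd3 (d := Fin 3)
  -- NNReal versions of the operator constants
  have hNN : 0 < NN := zero_lt_one.trans_le one_le_NN
  have hC₂0 := hc.hC₂0
  have hCℛ0 := hc.hCℛ0
  have hC₁0 := hc.hC₁0
  have hCh0 := hc.hCh0
  obtain ⟨C₂', hC₂'⟩ : ∃ C : ℝ≥0, (C : ℝ) = c.C₂ := ⟨⟨c.C₂, hC₂0⟩, rfl⟩
  obtain ⟨Cℛ', hCℛ'⟩ : ∃ C : ℝ≥0, (C : ℝ) = c.Cℛ := ⟨⟨c.Cℛ, hCℛ0⟩, rfl⟩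
  obtain ⟨C₁', hC₁'⟩ : ∃ C : ℝ≥0, (C : ℝ) = c.C₁ := ⟨⟨c.C₁, hC₁0⟩, rfl⟩
  obtain ⟨Ch', hCh'⟩ : ∃ C : ℝ≥0, (C : ℝ) = c.Ch := ⟨⟨c.Ch, hCh0⟩, rfl⟩
  have eC₂ : ENNReal.ofReal c.C₂ = (C₂' : ℝ≥0∞) := by rw [← hC₂', ENNReal.ofReal_coe_nnreal]
  have eCℛ : ENNReal.ofReal c.Cℛ = (Cℛ' : ℝ≥0∞) := by rw [← hCℛ', ENNReal.ofReal_coe_nnreal]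
  have eC₁ : ENNReal.ofReal c.C₁ = (C₁' : ℝ≥0∞) := by rw [← hC₁', ENNReal.ofReal_coe_nnreal]
  have eCh : ENNReal.ofReal c.Ch = (Ch' : ℝ≥0∞) := by rw [← hCh', ENNReal.ofReal_coe_nnreal]
  have hC₂ : ∀ w : 𝕋³ → ℝ, Torus.IsSmooth w → ∀ j k : Fin 3,
      eLpNorm (Torus.partialDeriv j (Torus.partialDeriv k w)) 2 volume ≤ C₂' * eLpNorm (Torus.laplacian w) 2 volume := by
    intro w hw j k; rw [← eC₂]; exact hc.hC₂ w hw j k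
  have hCℛ : ∀ A : 𝕋³ → Fin 3 → E³, Torus.IsSmooth A → eLpNorm (Torus.antidivergence (Torus.tensorDivergence A)) (ENNReal.ofReal c.pr) volume ≤
      Cℛ' * ∑ m, eLpNorm (fun y => A y m) (ENNReal.ofReal c.pr) volume := by
    intro A hA; rw [← eCℛ]; exact hc.hCℛ A hA
  have hC₁ : ∀ g : 𝕋³ → E³, Torus.IsSmooth g → eLpNorm (Torus.antidivergence g) 1 volume ≤ C₁' * eLpNorm g 1 volume := by
    intro g hg; rw [← eC₁]; exact hc.hC₁ g hg
  -- nonnegativity of the sizes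
  obtain ⟨hKeta, hKetaD⟩ := Datum.Keta_nonneg hD c.pr hB0 (B := c.B)
  have hK0 : 0 ≤ c.K := by
    have := ((hc.hK (Classical.arbitrary Idx) 0).1).nonneg
    have hs : 0 < Real.sqrt S.D.κ := Real.sqrt_pos.2 hκ0
    nlinarith
  have hCa0 : 0 ≤ c.Ca := (hc.ha (Classical.arbitrary Idx) 0 ⟨le_rfl, hD.hT.le⟩).nonneg
  have hV0 : 0 ≤ c.V₀ := (norm_nonneg _).trans (hc.hV 0 ⟨le_rfl, hD.hT.le⟩ (Classical.arbitrary _))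
  have hΨ0 : 0 ≤ c.Ψ₁ := (abs_nonneg _).trans (hc.hΨ 0)
  have hδM0 : 0 ≤ c.δM := (integral_nonneg fun y => norm_nonneg _).trans (hc.hδM 0)
  obtain ⟨hL1, -, -⟩ := Datum.Lstar_bounds hD hc.hκμ
  have hvB0 : 0 ≤ c.vB := (Finset.sum_nonneg fun x _ => ENNReal.toReal_nonneg).trans hc.hvB
  have nEp : 0 ≤ c.Ep S.D := by unfold Consts.Ep; have := hD.hγ; positivity
  have nLp : 0 ≤ c.Lp S.D := by unfold Consts.Lp; positivity
  have nSc : 0 ≤ c.Sc S.D := by unfold Consts.Sc; positivity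
  have nLc : 0 ≤ c.Lc S.D := by unfold Consts.Lc; positivity
  have nEX : 0 ≤ c.EX S.D := by unfold Consts.EX; positivity
  have nEζ : 0 ≤ c.Eζ S.D := by unfold Consts.Eζ; positivity
  have nEr : 0 ≤ c.Er S.D := by unfold Consts.Er; positivity
  have nLS : 0 ≤ c.LS S.D := by unfold Consts.LS; positivity
  have nLf₂ : 0 ≤ c.Lf₂ S.D := by unfold Consts.Lf₂; positivity
  have nLf₃ : 0 ≤ c.Lf₃ S.D := by unfold Consts.Lf₃; positivity
  have nLf₁ : 0 ≤ c.Lf₁ S.D := by unfold Consts.Lf₁; have := hc.hCℛ0; positivity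
  have nS₁ : 0 ≤ c.S₁ S.D := by unfold Consts.S₁; positivity
  have nvE : 0 ≤ c.vE S.D := by unfold Consts.vE; positivity
  have nHν : 0 ≤ c.Hν S.D := by
    unfold Consts.Hν
    have := hc.hCh0
    have h1 : 0 ≤ c.vE S.D ^ (1 / c.pr) := Real.rpow_nonneg nvE _
    have h2 : 0 ≤ c.S₁ S.D ^ (2 - c.θ) := Real.rpow_nonneg nS₁ _
    have h3 : 0 ≤ (3 * (c.S₁ S.D * S.D.Lstar ^ 2)) ^ (c.θ - 1) := Real.rpow_nonneg (by positivity) _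
    positivity
  have nincL1 : 0 ≤ c.incL1 S.D := by unfold Consts.incL1; positivity
  have nstress : 0 ≤ c.stress S.D := by
    unfold Consts.stress
    have := hc.hC₁0
    positivity
  -- the sizes at a time of the slab
  have sizes : ∀ t ∈ Icc 0 S.D.T,
      (∫ y, ‖S.D.wp t y‖ ^ 2 ≤ c.Ep S.D) ∧ (∫ y, ‖S.D.wp t y‖ ≤ c.Lp S.D) ∧
      (∀ y, ‖S.D.wpc t y - S.D.wp t y‖ ≤ c.Sc S.D) ∧ (∫ y, ‖S.D.wpc t y - S.D.wp t y‖ ≤ c.Lc S.D) ∧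
      (∫ y, ‖S.D.X t y‖ ^ 2 ≤ c.EX S.D) ∧ (∫ y, ‖Torus.gradient (S.D.zeta t) y‖ ^ 2 ≤ c.Eζ S.D) ∧
      (∫ y, ‖S.D.Sosc t y‖ ≤ c.LS S.D) ∧ (∫ y, ‖S.D.f₂ t y‖ ≤ c.Lf₂ S.D) ∧ (∫ y, ‖S.D.f₃ t y‖ ≤ c.Lf₃ S.D) ∧
      (∫ y, ‖Torus.antidivergence (S.D.f₁ t) y‖ ≤ c.Lf₁ S.D) := by
    intro t ht
    refine ⟨?_, Datum.integral_norm_wp_le hD hBD hAmp ht, fun y => Datum.norm_wc_le_sup hD hBD hB1 hAmp ht y,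
      Datum.integral_norm_wc_le hD hBD hAmp ht, Datum.integral_norm_X_sq_le hD hBD hB1 hAmp ht, ?_,
      (Datum.integral_norm_Sosc_f₂_le hD hAmp hBD ht).1, (Datum.integral_norm_Sosc_f₂_le hD hAmp hBD ht).2,
      Datum.integral_norm_f₃_le hD hAmp ht, ?_⟩
    · refine (Datum.integral_norm_wp_sq_le hD hAmp ht).trans ?_
      unfold Consts.Ep
      have hMδ' : ∫ y, ‖S.D.M t y‖ ≤ c.δM := hc.hδM t
      have h2r : 0 ≤ 2 / radius (Fin 3) := by positivity
      have h1 : 2 / radius (Fin 3) * (S.D.γ₀ + 3 * ∫ y, ‖S.D.M t y‖) ≤ 2 / radius (Fin 3) * (S.D.γ₀ + 3 * c.δM) :=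
        mul_le_mul_of_nonneg_left (by linarith) h2r
      exact mul_le_mul_of_nonneg_left (mul_le_mul_of_nonneg_left (add_le_add h1 le_rfl) (by norm_num : (0 : ℝ) ≤ 5)) hNN.le
    · refine Datum.integral_norm_gradient_zeta_sq_le hD ht (by show 0 ≤ c.Z S.D; unfold Consts.Z; positivity) fun i => ?_
      have := Datum.eLpNorm_partialDeriv_zeta_le hD hBD hB1 hAmp hC₂ ht i
      rw [hC₂'] at this
      exact this
    · have := (Datum.integral_norm_antidivergence_f₁_le hD hAmp hBD hB1 hc.hpr1.le hc.hpr2 hCℛ ht).2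
      rw [hCℛ'] at this
      exact this
  -- the hyperviscous size at a time of the slab
  have hyper : ∀ t ∈ Icc 0 S.D.T, ∫ y, ‖Torus.antidivergence (fun z => ν • Torus.fracLaplacian θ (S.wloc t) z) y‖ ≤ c.Hν S.D := by
    intro t ht
    have hpr1' : (1 : ℝ≥0∞) < ENNReal.ofReal c.pr := by
      rw [← ENNReal.ofReal_one]; exact (ENNReal.ofReal_lt_ofReal_iff (by linarith [hc.hpr1])).2 hc.hpr1
    have hChyp : ∀ u : 𝕋³ → E³, Torus.IsSmooth u → ∀ E : Set 𝕋³, MeasurableSet E →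
        (∀ m, ∀ y ∉ E, Torus.partialDeriv m u y = 0) → (∀ m, ∀ y ∉ E, Torus.laplacian (Torus.partialDeriv m u) y = 0) →
        ∀ S₁ S₃ : ℝ, 0 ≤ S₁ → 0 ≤ S₃ → (∀ m y, ‖Torus.partialDeriv m u y‖ ≤ S₁) →
        (∀ m y, ‖Torus.laplacian (Torus.partialDeriv m u) y‖ ≤ S₃) →
        eLpNorm (Torus.antidivergence (Torus.fracLaplacian θ u)) 1 volume ≤
          Ch' * (volume E ^ (1 / (ENNReal.ofReal c.pr).toReal) * ENNReal.ofReal (S₁ ^ (2 - θ) * S₃ ^ (θ - 1))) := by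
      intro u hu E hE h1 h3 S₁ S₃ hS₁ hS₃ b1 b3
      have := hc.hCh u hu E hE h1 h3 S₁ S₃ hS₁ hS₃ b1 b3
      rw [hcθ, eCh] at this
      exact this
    have key := eLpNorm_antidivergence_fracLaplacian_wloc_le h (θ := θ) (p := ENNReal.ofReal c.pr) (C := Ch') hChyp hc.hκμ hc.hK ht
      (fun x => hc.ha x t ht)
    simp only at key
    -- real form of the right-hand side
    have hpt : (ENNReal.ofReal c.pr).toReal = c.pr := ENNReal.toReal_ofReal (by linarith [hc.hpr1])
    rw [hpt] at key
    have hvol : volume (S.D.jetSupports t) ≤ ENNReal.ofReal (c.vE S.D) := by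
      refine (Datum.volume_jetSupports_le hD t).trans ?_
      have e : ∀ x : Idx, ENNReal.ofReal S.D.κ⁻¹ * (ENNReal.ofReal ((1 / 4 / S.D.μ) ^ Fintype.card (Slot x)) *
          volume (Metric.ball (0 : EuclideanSpace ℝ (Slot x)) 1)) =
          ENNReal.ofReal ((volume (Metric.ball (0 : EuclideanSpace ℝ (Slot x)) 1)).toReal * (S.D.κ⁻¹ * (1 / 4 / S.D.μ) ^ 2)) := by
        intro x
        have hfin : volume (Metric.ball (0 : EuclideanSpace ℝ (Slot x)) 1) ≠ ⊤ := measure_ball_lt_top.ne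
        rw [card_slot, Fintype.card_fin, show 3 - 1 = 2 from rfl, ENNReal.ofReal_mul ENNReal.toReal_nonneg, ENNReal.ofReal_toReal hfin,
          ENNReal.ofReal_mul (by positivity)]
        ring
      rw [Finset.sum_congr rfl fun x _ => e x, ← ENNReal.ofReal_sum_of_nonneg fun x _ => by positivity]
      refine ENNReal.ofReal_le_ofReal ?_
      rw [← Finset.sum_mul]
      unfold Consts.vE
      exact mul_le_mul_of_nonneg_right hc.hvB (by positivity)
    set S₁ := c.S₁ S.D with hS₁def
    have hS₁' : NN * (3 * (2 ^ 4 * c.Ca * (c.K * Real.sqrt S.D.κ * ((S.D.σ : ℝ))⁻¹) * S.D.Lstar)) * S.D.Lstar +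
        NN * (2 ^ 3 * (S.D.mup⁻¹ * (2 ^ 3 * (2 ^ 3 * c.Ca * c.Ca) * (c.K * S.D.κ * S.D.μ ^ 2))) * 3) * S.D.Lstar = S₁ := rfl
    rw [hS₁'] at key
    have hrhs : (Ch' : ℝ≥0∞) * (volume (S.D.jetSupports t) ^ (1 / c.pr) * ENNReal.ofReal (S₁ ^ (2 - θ) * (3 * (S₁ * S.D.Lstar ^ 2)) ^ (θ - 1))) ≤
        ENNReal.ofReal (c.Ch * ((c.vE S.D) ^ (1 / c.pr) * (S₁ ^ (2 - θ) * (3 * (S₁ * S.D.Lstar ^ 2)) ^ (θ - 1)))) := by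
      have hp0 : 0 ≤ 1 / c.pr := by have := hc.hpr1; positivity
      calc (Ch' : ℝ≥0∞) * (volume (S.D.jetSupports t) ^ (1 / c.pr) * ENNReal.ofReal (S₁ ^ (2 - θ) * (3 * (S₁ * S.D.Lstar ^ 2)) ^ (θ - 1)))
          ≤ (Ch' : ℝ≥0∞) * ((ENNReal.ofReal (c.vE S.D)) ^ (1 / c.pr) * ENNReal.ofReal (S₁ ^ (2 - θ) * (3 * (S₁ * S.D.Lstar ^ 2)) ^ (θ - 1))) := by
            gcongr
        _ = _ := by
            rw [ENNReal.ofReal_rpow_of_nonneg nvE hp0, ← ENNReal.ofReal_mul (Real.rpow_nonneg nvE _), ← eCh,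
              ← ENNReal.ofReal_mul hc.hCh0]
    have key2 := key.trans hrhs
    -- `∫‖ℛ(ν•Λwloc)‖ = |ν| ∫‖ℛ(Λ wloc)‖`
    have hwl : Torus.IsSmooth (S.wloc t) := (smooth_wloc h).isSmooth_slice (mem_univ t)
    have hΛ : Torus.IsSmooth (Torus.fracLaplacian θ (S.wloc t)) := hwl.fracLaplacian hθ0.le
    have hA : Torus.IsSmooth (Torus.antidivergence (Torus.fracLaplacian θ (S.wloc t))) := Torus.isSmooth_antidivergence hΛ
    have hI := integral_norm_le_of_eLpNorm_one_le hA.continuous (by have := hc.hCh0; positivity) key2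
    have e : (fun z => ν • Torus.fracLaplacian θ (S.wloc t) z) = ν • Torus.fracLaplacian θ (S.wloc t) := rfl
    rw [e, Torus.antidivergence_const_smul hΛ]
    calc ∫ y, ‖(ν • Torus.antidivergence (Torus.fracLaplacian θ (S.wloc t))) y‖ = |ν| * ∫ y, ‖Torus.antidivergence (Torus.fracLaplacian θ (S.wloc t)) y‖ := by
          rw [← integral_const_mul]
          refine integral_congr_ae (Eventually.of_forall fun y => ?_)
          simp [norm_smul]
      _ ≤ |ν| * (c.Ch * ((c.vE S.D) ^ (1 / c.pr) * (S₁ ^ (2 - θ) * (3 * (S₁ * S.D.Lstar ^ 2)) ^ (θ - 1)))) := mul_le_mul_of_nonneg_left hI (abs_nonneg ν)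
      _ = c.Hν S.D := by unfold Consts.Hν; rw [hcθ, hcν]
  -- conclusions
  refine ⟨fun t => ?_, fun t => ?_, fun t => ?_⟩
  · by_cases ht : t ∈ tsupport S.ψ
    · have htI := tsupport_subset_Icc h ht
      obtain ⟨iEp, -, iSc, iLc, iEX, iEζ, -⟩ := sizes t htI
      exact eLpNorm_w_le h htI iEp iSc iLc iEX iEζ
    · rw [(w_newStress_eq_zero_of_not_mem (S := S) (θ := θ) (ν := ν) v ht).1, eLpNorm_zero]; exact bot_le
  · by_cases ht : t ∈ tsupport S.ψ
    · have htI := tsupport_subset_Icc h ht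
      obtain ⟨-, iLp, -, iLc, iEX, iEζ, -⟩ := sizes t htI
      exact integral_norm_w_le h htI iLp iLc iEX iEζ
    · rw [(w_newStress_eq_zero_of_not_mem (S := S) (θ := θ) (ν := ν) v ht).1]; simpa using nincL1
  · by_cases ht : t ∈ tsupport S.ψ
    · have htI := tsupport_subset_Icc h ht
      obtain ⟨iEp, iLp, iSc, iLc, iEX, iEζ, iS, if2, if3, if1⟩ := sizes t htI
      have hvs : Torus.IsSmooth (v t) := hv.smooth_velocity.isSmooth_slice (mem_univ t)
      have main := integral_norm_newStress_le h hθ0 htI hvs (hc.hV t htI) iEp iLp iSc iLc iEX iEζ iS if2 if3 if1 (hc.hΨ t) hC₁ (hyper t htI)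
      rw [hC₁'] at main
      exact main
    · rw [(w_newStress_eq_zero_of_not_mem (S := S) (θ := θ) (ν := ν) v ht).2]; simpa using nstress

end Setup

end LuoTiti

end Literature.Analysis.FluidPDE
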